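import Literature.NumberTheory.LFunctions.Zhang2022.DHMenuConsistentP4

/-!
# Zhang (2022), rung F-S3, family B-dh — the (A)-world `W(D, χ)` of `DHChainBarrier`: the REMAINING world lemmas
# (fence ordinates are positive; real zeros; multiplicities; the window at every level; symmetries) for `DH.MenuConsistent`

Y. Zhang, *Discrete mean estimates and the Landau–Siegel zero*, arXiv:2211.02515v1 [Zhang2022LandauSiegel] — an unrefereed
manuscript under adjudication. **The programme SEARCHES and TYPES; no claim about Landau–Siegel zeros, Theorems 1–2 of
arXiv:2211.02515 or a repaired Margin232 until a kernel theorem says so.** Nothing here is a statement about a Dirichlet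
`L`-function: `DH.world D χ` (p461081/p461386) is abstract zero/value DATA and every theorem below is elementary bookkeeping
about that data. Cell `landau-siegel`, sub-cell E, stub S-E-p4-5 (ls-barrier-plan 19:14:21Z); per-field proof map
B-dh/SIGMA-E-HANDOVER.md v1 (85415a87d174988f), «WORLD FACTS W1–W7». COMPLEMENT of ls-Bdh-typer-1's `DHMenuConsistentP4`
(W0/W1, `fence_re`, `mem_excPair_iff`, the `IsExcSlot` algebra, `re_gt_half_zero`, `betaExc_window`, the numerics at
`log D ≥ 43250`, and rows 01/02/03/08/09/10/11/12/15/19/S3 are THERE and are cited, not restated).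

## Contents (`w := world D χ`, `γ_n(f) := fenceOrdinate f n`, `F_f := rvmMain f`, `β₁ := betaExc D`)

* W2 (fence ordinates): `mem_fence_iff`, `abs_im_of_mem_fence`, `rvmMain_zero`, `rvmMain_nonpos` (`F_f ≤ 0` on
  `[0, 2πe/f]`), `two_pi_e_div_lt_of_mem_fenceSet`, `fenceSet_nonempty` (`F_f(T) ≥ T/π` once `fT ≥ 2πe²`),
  **`two_pi_e_div_le_fenceOrdinate` / `fenceOrdinate_pos`** (`γ_n(f) ≥ 2πe/f > 0` for `f, n ≥ 1`), `im_ne_zero_of_mem_fence`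
  (fence points are OFF the real axis), `not_mem_excPair_of_mem_fence`.
* W3 extras: `re_of_mem_excPair`, `im_of_mem_excPair`, `IsExcSlot.dvd`, `mult_world_le_one` / `isZero_world_iff_mult_eq_one`
  (every multiplicity is `0` or `1` at positive level), `not_isZero_one` (`1` is never a zero, `log D ≥ 43250`).
* W4 (real zeros): **`isZero_ofReal_iff : w.IsZero q ψ β ↔ IsExcSlot D χ q ψ ∧ (β = β₁ ∨ β = 1 − β₁)`** (`q ≠ 0`),
  `not_isZero_ofReal_of_not_exc`, `isZero_betaExc_of_exc`, `isZero_pair_self`.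
* W5 (values): `world_LOne_of_exc` (`= λ`), `world_LOne_of_not_exc` (`= 1`), `lam_le_half`, `world_LOne_pos_le` (`0 < LOne ≤ 1`).
* W6 (window at EVERY level): `one_div_ten_log_le_half` (`1/(10 log q) ≤ ½` for all `q : ℕ`), **`window_zero`** (a real zero
  `β > 1 − 1/(10 log q)` of any slot of any level `q ≠ 0` is `β₁` on an exceptional slot).
* Symmetries for rowS1: `conj_mem_fence_iff`, `one_sub_conj_mem_fence_iff`, `conj_mem_excPair_iff`,
  `one_sub_conj_mem_excPair_iff`, and the slot-wise `mult_symm` (given `conductor ψ⁻¹ = conductor ψ` and the exceptional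
  status of `ψ⁻¹`, e.g. `isExcSlot_inv_iff` for quadratic `χ`).

W7 (strict monotonicity of `γ_n`, finiteness of the fence below a height, the count identity `2⌊(F_f(T)+1)/2⌋₊` for
`stripCount`) is the companion `DHMenuConsistentFence` (row13a). References as in `DHChainBarrier`/`DHMenuConsistentP4`.
-/

noncomputable section

open scoped Classical
open Complex

namespace Literature.NumberTheory.LFunctions.Zhang2022.DH

/-! ### W2 — the fence ordinates are positive -/

/-- Membership in the fence at conductor `f`. [cite: BennettMartinOBryantRechnitzer2021, Theorem 1.1] -/
theorem mem_fence_iff {f : ℕ} {ρ : ℂ} :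
    ρ ∈ fence f ↔ (∃ n : ℕ, ρ = 1 / 2 + ((fenceOrdinate f (n + 1) : ℝ) : ℂ) * I) ∨
      ∃ n : ℕ, ρ = 1 / 2 - ((fenceOrdinate f (n + 1) : ℝ) : ℂ) * I := by
  simp only [fence, Set.mem_union, Set.mem_range, eq_comm]

/-- The ordinate of a fence point is `± γ_{n+1}(f)`. [cite: BennettMartinOBryantRechnitzer2021, Theorem 1.1] -/
theorem abs_im_of_mem_fence {f : ℕ} {ρ : ℂ} (h : ρ ∈ fence f) : ∃ n : ℕ, |ρ.im| = |fenceOrdinate f (n + 1)| := by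
  rcases mem_fence_iff.1 h with ⟨n, rfl⟩ | ⟨n, rfl⟩ <;> exact ⟨n, by simp⟩

/-- `F_f(0) = 0`. [cite: BennettMartinOBryantRechnitzer2021, Theorem 1.1] -/
theorem rvmMain_zero (f : ℕ) : rvmMain f 0 = 0 := by simp [rvmMain]

/-- `F_f(T) ≤ 0` on `0 ≤ T ≤ 2πe/f` (`f ≥ 1`): the main term is not positive before `fT = 2πe`.
[cite: BennettMartinOBryantRechnitzer2021, Theorem 1.1] -/
theorem rvmMain_nonpos {f : ℕ} (hf : 1 ≤ f) {T : ℝ} (hT0 : 0 ≤ T) (hT : T ≤ 2 * Real.pi * Real.exp 1 / f) :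
    rvmMain f T ≤ 0 := by
  have hf' : (0:ℝ) < f := by exact_mod_cast hf
  have hden : 0 < 2 * Real.pi * Real.exp 1 := by positivity
  unfold rvmMain
  have hx : (f : ℝ) * T / (2 * Real.pi * Real.exp 1) ≤ 1 := by
    rw [div_le_one hden]
    calc (f : ℝ) * T ≤ f * (2 * Real.pi * Real.exp 1 / f) := by gcongr
      _ = 2 * Real.pi * Real.exp 1 := by field_simp
  have hlog : Real.log ((f : ℝ) * T / (2 * Real.pi * Real.exp 1)) ≤ 0 :=
    Real.log_nonpos (by positivity) hx
  exact mul_nonpos_of_nonneg_of_nonpos (by positivity) hlog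

/-- Every admissible height of the infimum defining `γ_n(f)` (`n, f ≥ 1`) lies beyond `2πe/f`.
[cite: BennettMartinOBryantRechnitzer2021, Theorem 1.1] -/
theorem two_pi_e_div_lt_of_mem_fenceSet {f n : ℕ} (hf : 1 ≤ f) (hn : 1 ≤ n) {T : ℝ}
    (hT : T ∈ {T : ℝ | 0 ≤ T ∧ (2 * (n : ℝ) - 1) ≤ rvmMain f T}) : 2 * Real.pi * Real.exp 1 / f < T := by
  obtain ⟨hT0, hTn⟩ := hT
  have hn' : (1:ℝ) ≤ n := by exact_mod_cast hn
  by_contra hle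
  have := rvmMain_nonpos hf hT0 (not_lt.1 hle)
  linarith

/-- The defining set of `γ_n(f)` is nonempty (`f ≥ 1`): `F_f(T) ≥ T/π` once `fT ≥ 2πe²`.
[cite: BennettMartinOBryantRechnitzer2021, Theorem 1.1] -/
theorem fenceSet_nonempty {f : ℕ} (hf : 1 ≤ f) (n : ℕ) :
    {T : ℝ | 0 ≤ T ∧ (2 * (n : ℝ) - 1) ≤ rvmMain f T}.Nonempty := by
  have hf' : (1:ℝ) ≤ f := by exact_mod_cast hf
  have hπ : 0 < Real.pi := Real.pi_pos
  set T : ℝ := max (2 * Real.pi * Real.exp 1 ^ 2) (Real.pi * (2 * n)) with hTdef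
  have hT1 : 2 * Real.pi * Real.exp 1 ^ 2 ≤ T := le_max_left _ _
  have hT2 : Real.pi * (2 * n) ≤ T := le_max_right _ _
  have hTpos : 0 < T := lt_of_lt_of_le (by positivity) hT1
  refine ⟨T, hTpos.le, ?_⟩
  have hx : Real.exp 1 ≤ (f : ℝ) * T / (2 * Real.pi * Real.exp 1) := by
    rw [le_div_iff₀ (by positivity)]
    calc Real.exp 1 * (2 * Real.pi * Real.exp 1) = 1 * (2 * Real.pi * Real.exp 1 ^ 2) := by ring
      _ ≤ (f : ℝ) * T := by gcongr
  have hlog : 1 ≤ Real.log ((f : ℝ) * T / (2 * Real.pi * Real.exp 1)) := by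
    rw [Real.le_log_iff_exp_le (by positivity)]
    exact hx
  unfold rvmMain
  calc 2 * (n : ℝ) - 1 ≤ 2 * n := by linarith
    _ = Real.pi * (2 * n) / Real.pi * 1 := by field_simp
    _ ≤ T / Real.pi * Real.log ((f : ℝ) * T / (2 * Real.pi * Real.exp 1)) := by gcongr

/-- `γ_n(f) ≥ 2πe/f` for `f, n ≥ 1`. [cite: BennettMartinOBryantRechnitzer2021, Theorem 1.1] -/
theorem two_pi_e_div_le_fenceOrdinate {f n : ℕ} (hf : 1 ≤ f) (hn : 1 ≤ n) :
    2 * Real.pi * Real.exp 1 / f ≤ fenceOrdinate f n :=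
  le_csInf (fenceSet_nonempty hf n) fun _ hT => (two_pi_e_div_lt_of_mem_fenceSet hf hn hT).le

/-- **`0 < γ_n(f)`** for `f, n ≥ 1`. [cite: BennettMartinOBryantRechnitzer2021, Theorem 1.1] -/
theorem fenceOrdinate_pos {f n : ℕ} (hf : 1 ≤ f) (hn : 1 ≤ n) : 0 < fenceOrdinate f n :=
  have hf' : (0:ℝ) < f := by exact_mod_cast hf
  lt_of_lt_of_le (div_pos (by positivity) hf') (two_pi_e_div_le_fenceOrdinate hf hn)

/-- **Fence points are off the real axis** (`f ≥ 1`). [cite: BennettMartinOBryantRechnitzer2021, Theorem 1.1] -/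
theorem im_ne_zero_of_mem_fence {f : ℕ} (hf : 1 ≤ f) {ρ : ℂ} (h : ρ ∈ fence f) : ρ.im ≠ 0 := by
  have key : ∀ n : ℕ, fenceOrdinate f (n + 1) ≠ 0 := fun n => (fenceOrdinate_pos hf (Nat.succ_le_succ (Nat.zero_le n))).ne'
  rcases mem_fence_iff.1 h with ⟨n, rfl⟩ | ⟨n, rfl⟩ <;> simpa using key n

/-- The conductor of a character of positive level is `≥ 1`. [folklore] -/
private theorem one_le_conductor {q : ℕ} [NeZero q] (ψ : DirichletCharacter ℂ q) : 1 ≤ ψ.conductor :=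
  Nat.one_le_iff_ne_zero.2 (DirichletCharacter.conductor_ne_zero ψ)

/-! ### W3 extras — the pair is real, multiplicities are `≤ 1`, `1` is never a zero -/

/-- The exceptional pair is real. [cite: Zhang2022LandauSiegel, §2 Assumption (A)] -/
theorem im_of_mem_excPair {D : ℕ} {ρ : ℂ} (h : ρ ∈ excPair D) : ρ.im = 0 := by
  rcases mem_excPair_iff.1 h with rfl | rfl <;> simp

/-- Real parts of the exceptional pair. [cite: Zhang2022LandauSiegel, §2 Assumption (A)] -/
theorem re_of_mem_excPair {D : ℕ} {ρ : ℂ} (h : ρ ∈ excPair D) : ρ.re = betaExc D ∨ ρ.re = 1 - betaExc D := by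
  rcases mem_excPair_iff.1 h with rfl | rfl <;> simp

/-- The fence and the exceptional pair are disjoint (`f ≥ 1`). [cite: Zhang2022LandauSiegel, §2 Assumption (A)] -/
theorem not_mem_excPair_of_mem_fence {f : ℕ} (hf : 1 ≤ f) {D : ℕ} {ρ : ℂ} (h : ρ ∈ fence f) : ρ ∉ excPair D :=
  fun h' => im_ne_zero_of_mem_fence hf h (im_of_mem_excPair h')

/-- An exceptional slot has level divisible by `D`. [cite: MontgomeryVaughan2007, §9.1] -/
theorem IsExcSlot.dvd {D : ℕ} {χ : DirichletCharacter ℂ D} {q : ℕ} {ψ : DirichletCharacter ℂ q}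
    (h : IsExcSlot D χ q ψ) : D ∣ q := h.1

/-- **Every multiplicity of `W(D,χ)` is `≤ 1`** at positive level (fence and pair are disjoint).
[cite: Zhang2022LandauSiegel, §2 Assumption (A)] -/
theorem mult_world_le_one {D : ℕ} (χ : DirichletCharacter ℂ D) {q : ℕ} [NeZero q] (ψ : DirichletCharacter ℂ q)
    (ρ : ℂ) : (world D χ).mult q ψ ρ ≤ 1 := by
  rw [world_mult]
  by_cases h1 : ρ ∈ fence ψ.conductor
  · have h2 : ¬ (IsExcSlot D χ q ψ ∧ ρ ∈ excPair D) :=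
      fun h => not_mem_excPair_of_mem_fence (one_le_conductor ψ) h1 h.2
    simp [h1, h2]
  · by_cases h2 : IsExcSlot D χ q ψ ∧ ρ ∈ excPair D <;> simp [h1, h2]

/-- At positive level, `IsZero ↔ mult = 1` (every zero of `W` is simple). [cite: Zhang2022LandauSiegel, §2 Assumption (A)] -/
theorem isZero_world_iff_mult_eq_one {D : ℕ} (χ : DirichletCharacter ℂ D) {q : ℕ} [NeZero q]
    {ψ : DirichletCharacter ℂ q} {ρ : ℂ} : (world D χ).IsZero q ψ ρ ↔ (world D χ).mult q ψ ρ = 1 := by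
  have h := mult_world_le_one χ ψ ρ
  unfold ZeroWorld.IsZero
  omega

/-- **`1` is not a zero** of any slot of `W(D,χ)` (`log D ≥ 43250`): `Re 1 = 1 ≠ ½` and `1 ∉ {β₁, 1 − β₁}`.
[cite: Zhang2022LandauSiegel, §2 Assumption (A)] -/
theorem not_isZero_one {D : ℕ} {χ : DirichletCharacter ℂ D} (hL : (43250 : ℝ) ≤ Real.log D) {q : ℕ}
    {ψ : DirichletCharacter ℂ q} : ¬ (world D χ).IsZero q ψ 1 := by
  intro hz
  obtain ⟨-, h⟩ := re_gt_half_zero hL hz (by norm_num)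
  have := congrArg Complex.re h
  simp at this
  linarith [(betaExc_window hL).2]

/-! ### W4 — real zeros -/

/-- **The real zeros of `W(D,χ)`**: exactly `β₁` and `1 − β₁`, exactly on the exceptional slots (no fence point is real;
level `q ≠ 0`). [cite: Zhang2022LandauSiegel, §2 Assumption (A)] -/
theorem isZero_ofReal_iff {D : ℕ} (χ : DirichletCharacter ℂ D) {q : ℕ} [NeZero q] {ψ : DirichletCharacter ℂ q}
    {β : ℝ} : (world D χ).IsZero q ψ (β : ℂ) ↔ IsExcSlot D χ q ψ ∧ (β = betaExc D ∨ β = 1 - betaExc D) := by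
  rw [isZero_world_iff]
  have hnot : ((β : ℝ) : ℂ) ∉ fence ψ.conductor :=
    fun h => im_ne_zero_of_mem_fence (one_le_conductor ψ) h (Complex.ofReal_im β)
  simp only [hnot, false_or, mem_excPair_iff, Complex.ofReal_inj]

/-- A NON-exceptional slot has no real zero. [cite: Zhang2022LandauSiegel, §2 Assumption (A)] -/
theorem not_isZero_ofReal_of_not_exc {D : ℕ} (χ : DirichletCharacter ℂ D) {q : ℕ} [NeZero q]
    {ψ : DirichletCharacter ℂ q} (h : ¬ IsExcSlot D χ q ψ) (β : ℝ) : ¬ (world D χ).IsZero q ψ (β : ℂ) :=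
  fun hz => h ((isZero_ofReal_iff χ).1 hz).1

/-- The pair ARE zeros of an exceptional slot. [cite: Zhang2022LandauSiegel, §2 Assumption (A)] -/
theorem isZero_betaExc_of_exc {D : ℕ} (χ : DirichletCharacter ℂ D) {q : ℕ} {ψ : DirichletCharacter ℂ q}
    (h : IsExcSlot D χ q ψ) :
    (world D χ).IsZero q ψ ((betaExc D : ℝ) : ℂ) ∧ (world D χ).IsZero q ψ ((1 - betaExc D : ℝ) : ℂ) :=
  ⟨isZero_world_iff.2 (Or.inr ⟨h, mem_excPair_iff.2 (Or.inl rfl)⟩),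
    isZero_world_iff.2 (Or.inr ⟨h, mem_excPair_iff.2 (Or.inr rfl)⟩)⟩

/-- In particular both `β₁` and `1 − β₁` are zeros of the slot `(D, χ)`. [cite: Zhang2022LandauSiegel, §2 Assumption (A)] -/
theorem isZero_pair_self {D : ℕ} (χ : DirichletCharacter ℂ D) :
    (world D χ).IsZero D χ ((betaExc D : ℝ) : ℂ) ∧ (world D χ).IsZero D χ ((1 - betaExc D : ℝ) : ℂ) :=
  isZero_betaExc_of_exc χ isExcSlot_self

/-! ### W5 — values -/

/-- `LOne = λ` on an exceptional slot. [cite: Zhang2022LandauSiegel, §2 Assumption (A)] -/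
theorem world_LOne_of_exc {D : ℕ} (χ : DirichletCharacter ℂ D) {q : ℕ} {ψ : DirichletCharacter ℂ q}
    (h : IsExcSlot D χ q ψ) : (world D χ).LOne q ψ = lam D := by
  rw [world_LOne, if_pos h]

/-- `LOne = 1` on a non-exceptional slot. [cite: Zhang2022LandauSiegel, §2 Assumption (A)] -/
theorem world_LOne_of_not_exc {D : ℕ} (χ : DirichletCharacter ℂ D) {q : ℕ} {ψ : DirichletCharacter ℂ q}
    (h : ¬ IsExcSlot D χ q ψ) : (world D χ).LOne q ψ = 1 := by
  rw [world_LOne, if_neg h]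

/-- `λ ≤ ½` for `log D ≥ 1` (the exceptional value is the SMALLER one). [cite: Zhang2022LandauSiegel, §2 Assumption (A)] -/
theorem lam_le_half {D : ℕ} (hL : 1 ≤ Real.log D) : lam D ≤ 1 / 2 := by
  unfold lam
  have h : (1:ℝ) ≤ Real.log D ^ 2022 := one_le_pow₀ hL
  rw [div_le_div_iff₀ (by positivity) (by norm_num)]
  linarith

/-- `0 < LOne ≤ 1` on every slot (`log D ≥ 1`). [cite: Zhang2022LandauSiegel, §2 Assumption (A)] -/
theorem world_LOne_pos_le {D : ℕ} (χ : DirichletCharacter ℂ D) (hL : 1 ≤ Real.log D) (q : ℕ)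
    (ψ : DirichletCharacter ℂ q) : 0 < (world D χ).LOne q ψ ∧ (world D χ).LOne q ψ ≤ 1 := by
  rw [world_LOne]
  split_ifs
  · refine ⟨?_, (lam_le_half hL).trans (by norm_num)⟩
    unfold lam; positivity
  · exact ⟨one_pos, le_rfl⟩

/-! ### W6 — the window `(1 − 1/(10 log q), 1)` at EVERY level -/

/-- For every natural `q`, `1/(10 log q) ≤ ½` (`log q = 0` for `q ≤ 1`; `log q ≥ log 2 > ⅕` otherwise).
[cite: BenliGoelTwissZaman2025, Corollary 1.1] -/
theorem one_div_ten_log_le_half (q : ℕ) : 1 / (10 * Real.log q) ≤ 1 / 2 := by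
  rcases Nat.lt_or_ge q 2 with hq | hq
  · interval_cases q <;> simp
  · have h2 : (2:ℝ) ≤ q := by exact_mod_cast hq
    have hlog : Real.log 2 ≤ Real.log q := Real.log_le_log (by norm_num) h2
    have hl2 : (1:ℝ) / 5 < Real.log 2 := by
      have := Real.log_two_gt_d9; linarith
    rw [div_le_div_iff₀ (by nlinarith) (by norm_num)]
    nlinarith

/-- **A real zero inside ANY window is `β₁`**: if `1 − 1/(10 log q) < β` and `β` is a zero of a slot of level `q ≠ 0`, then
the slot is exceptional and `β = β₁` (the partner `1 − β₁ < ½ ≤ 1 − 1/(10 log q)` never qualifies; `log D ≥ 43250`).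
[cite: BenliGoelTwissZaman2025, Corollary 1.1] -/
theorem window_zero {D : ℕ} {χ : DirichletCharacter ℂ D} (hL : (43250 : ℝ) ≤ Real.log D) {q : ℕ} [NeZero q]
    {ψ : DirichletCharacter ℂ q} {β : ℝ} (hwin : 1 - 1 / (10 * Real.log q) < β) (hz : (world D χ).IsZero q ψ β) :
    IsExcSlot D χ q ψ ∧ β = betaExc D := by
  obtain ⟨hslot, hβ⟩ := (isZero_ofReal_iff χ).1 hz
  refine ⟨hslot, hβ.resolve_right fun h => ?_⟩
  have hb := one_sub_betaExc_lt_half hL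
  have hq := one_div_ten_log_le_half q
  rw [h] at hwin
  linarith

/-! ### Symmetries of the zero data (for rowS1) -/

/-- `conj (½ ± iγ) = ½ ∓ iγ`. [folklore] -/
private theorem conj_half_add (γ : ℝ) :
    starRingEnd ℂ (1 / 2 + (γ : ℂ) * I) = 1 / 2 - (γ : ℂ) * I ∧
      starRingEnd ℂ (1 / 2 - (γ : ℂ) * I) = 1 / 2 + (γ : ℂ) * I := by
  constructor <;> apply Complex.ext <;> simp

/-- `1 − conj (½ ± iγ) = ½ ± iγ`. [folklore] -/
private theorem one_sub_conj_half_add (γ : ℝ) :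
    1 - starRingEnd ℂ (1 / 2 + (γ : ℂ) * I) = 1 / 2 + (γ : ℂ) * I ∧
      1 - starRingEnd ℂ (1 / 2 - (γ : ℂ) * I) = 1 / 2 - (γ : ℂ) * I := by
  constructor <;> apply Complex.ext <;> simp <;> norm_num

/-- The fence is closed under complex conjugation. [folklore] -/
private theorem conj_mem_fence {f : ℕ} {ρ : ℂ} (h : ρ ∈ fence f) : starRingEnd ℂ ρ ∈ fence f := by
  rcases mem_fence_iff.1 h with ⟨n, rfl⟩ | ⟨n, rfl⟩
  · exact mem_fence_iff.2 (Or.inr ⟨n, (conj_half_add _).1⟩)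
  · exact mem_fence_iff.2 (Or.inl ⟨n, (conj_half_add _).2⟩)

/-- `ρ ↦ ρ̄` preserves the fence. [cite: BennettMartinOBryantRechnitzer2021, Theorem 1.1] -/
theorem conj_mem_fence_iff {f : ℕ} {ρ : ℂ} : starRingEnd ℂ ρ ∈ fence f ↔ ρ ∈ fence f :=
  ⟨fun h => by simpa using conj_mem_fence h, conj_mem_fence⟩

/-- `ρ ↦ 1 − ρ̄` preserves the fence (it FIXES every fence point). [cite: BennettMartinOBryantRechnitzer2021, Theorem 1.1] -/
theorem one_sub_conj_mem_fence_iff {f : ℕ} {ρ : ℂ} : 1 - starRingEnd ℂ ρ ∈ fence f ↔ ρ ∈ fence f := by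
  have key : ∀ ρ : ℂ, ρ ∈ fence f → 1 - starRingEnd ℂ ρ = ρ := by
    intro ρ h
    rcases mem_fence_iff.1 h with ⟨n, rfl⟩ | ⟨n, rfl⟩
    · exact (one_sub_conj_half_add _).1
    · exact (one_sub_conj_half_add _).2
  constructor
  · intro h
    have e : 1 - starRingEnd ℂ (1 - starRingEnd ℂ ρ) = ρ := by simp
    rw [← e, key _ h]
    exact h
  · intro h; rw [key ρ h]; exact h

/-- `ρ ↦ ρ̄` preserves the (real) exceptional pair. [cite: Zhang2022LandauSiegel, §2 Assumption (A)] -/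
theorem conj_mem_excPair_iff {D : ℕ} {ρ : ℂ} : starRingEnd ℂ ρ ∈ excPair D ↔ ρ ∈ excPair D := by
  have key : ∀ ρ : ℂ, ρ ∈ excPair D → starRingEnd ℂ ρ = ρ := by
    intro ρ h; rcases mem_excPair_iff.1 h with rfl | rfl <;> exact Complex.conj_ofReal _
  constructor
  · intro h
    have e : starRingEnd ℂ (starRingEnd ℂ ρ) = ρ := Complex.conj_conj ρ
    rw [← e, key _ h]
    exact h
  · intro h; rw [key ρ h]; exact h

/-- `ρ ↦ 1 − ρ̄` preserves the exceptional pair (it SWAPS `β₁` and `1 − β₁`). [cite: Zhang2022LandauSiegel, §2 Assumption (A)] -/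
theorem one_sub_conj_mem_excPair_iff {D : ℕ} {ρ : ℂ} : 1 - starRingEnd ℂ ρ ∈ excPair D ↔ ρ ∈ excPair D := by
  have key : ∀ ρ : ℂ, ρ ∈ excPair D → 1 - starRingEnd ℂ ρ ∈ excPair D := by
    intro ρ h
    rcases mem_excPair_iff.1 h with rfl | rfl
    · exact mem_excPair_iff.2 (Or.inr (by rw [Complex.conj_ofReal]; push_cast; ring))
    · exact mem_excPair_iff.2 (Or.inl (by rw [Complex.conj_ofReal]; push_cast; ring))
  constructor
  · intro h
    have := key _ h
    simpa using this
  · exact key ρ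

/-- **rowS1's zero clause on one slot**: whenever `ψ⁻¹` and `ψ` have the same conductor and the same exceptional status
(both automatic for quadratic `χ` — `isExcSlot_inv_iff`; the conductor identity is the rowS1 owner's Mathlib step), the
multiplicities are invariant under `(ψ, ρ) ↦ (ψ⁻¹, ρ̄)` and under `ρ ↦ 1 − ρ̄`. [cite: Zhang2022LandauSiegel, §2 Assumption (A)] -/
theorem mult_symm {D : ℕ} (χ : DirichletCharacter ℂ D) {q : ℕ} (ψ : DirichletCharacter ℂ q) (ρ : ℂ)
    (hcond : (ψ⁻¹).conductor = ψ.conductor) (hexc : IsExcSlot D χ q ψ⁻¹ ↔ IsExcSlot D χ q ψ) :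
    (world D χ).mult q ψ⁻¹ (starRingEnd ℂ ρ) = (world D χ).mult q ψ ρ ∧
      (world D χ).mult q ψ (1 - starRingEnd ℂ ρ) = (world D χ).mult q ψ ρ := by
  rw [world_mult, world_mult, world_mult, hcond]
  simp only [conj_mem_fence_iff, one_sub_conj_mem_fence_iff, conj_mem_excPair_iff, one_sub_conj_mem_excPair_iff, hexc,
    and_self]

end Literature.NumberTheory.LFunctions.Zhang2022.DH
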